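import Literature.MathematicalPhysics.QuantumFieldTheory.Balaban1983to89.B10Eq24Cumulant
import HarnessLib

/-!
# Crux `FluctuationComparisonRegPrIntL` (stmt-QuantumFields-20520, rung R3), PATH-B organ O1, LINE g25-1 «organ_tangent», row JEN∘ `JensenGapCan` —
# TOOLS for the knit «JEN∘ ⟸ (A) ∧ JVAR∘»: the cumulant Taylor formula with INTEGRAL remainder, four-point combinations under the `t`-integral,
# and «a disintegration computes push-forward densities»

LEAD-20520 width seat ym-ust-20520-w3 g23 (cell ym3-torus), `--supports stmt-QuantumFields-20520` (helper).  THEOREMS ONLY, def-free, generic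
[folklore] calculus ∕ measure theory over Mathlib (`ProbabilityTheory.cgf`, `Measure.tilted`, `variance_tilted_mul`, integration by parts) and the
tree (✓`B10Eq24Cumulant.contDiff_cgf_of_abs_le` — `f = cgf V ν` is smooth for a bounded variable under a finite measure).

* §1 ★`sub_sub_deriv_eq_integral_of_contDiff_two`: `f 1 − f 0 − f′ 0 = ∫₀¹ (1 − t)·f″(t) dt` for `C²` `f : ℝ → ℝ`; ★`cgf_one_sub_cgf_zero_sub_deriv_eq_integral`
  ∕ `…_variance`: for `|V| ≤ B` `ν`-a.e., `ν` finite, `log ∫ e^{V} dν − log ν(univ) − f′(0) = ∫₀¹ (1 − t)·f″(t) dt = ∫₀¹ (1 − t)·Var[V; ν.tilted (t·V)] dt`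
  — the EXACT second-order cumulant expansion (Lagrange form: ✓`B10Eq24Cumulant.cgf_taylor_lagrange`; the integral form is what lets four-point
  combinations in an external parameter pass through); `continuous_variance_tilted_of_abs_le`.
* §2 `integral_one_sub_id`, ★`abs_fourPoint_integral_le`, ★`abs_fourPoint_le_of_eq_integral`: if `q x = ∫₀¹ (1 − t)·A_x(t) dt` with `A_x` continuous,
  a `t`-uniform bound `W₀·e` on a four-point combination of the `A_x` gives `(W₀∕2)·e` for the same combination of `q`.
* §3 ★`map_withDensity_eq_withDensity_lintegral`: `(m.map d).bind σ = m` with `σ_V` carried by `{d = V}` ⟹ `(F·m).map d = (V ↦ ∫ F dσ_V)·(m.map d)`.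

HONEST FRAMING: elementary; nothing of Bałaban's is asserted or proved; JVAR∘, (A), JEN∘, LIN∘, VER∘, O1, crux 20520, `YM3TorusSU2` are NOT proved;
registry `Lines/semiclassical_s2beta.lean` v11.4 (★★OWNER RULING №36) untouched; rung R3 = SU(2) YM₃ on T³ — NOT d = 4, NOT infinite volume, NOT a
mass gap, NOT Clay; the Yang–Mills mass gap is NOT proved by any of this.
-/

set_option autoImplicit false

noncomputable section

namespace Summit.QuantumFields.YangMills.Theorems.OrganTangentJensenGapTools

open MeasureTheory ProbabilityTheory Filter Topology Set intervalIntegral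
open scoped ENNReal
open Literature.MathematicalPhysics.QuantumFieldTheory.Balaban1983to89.B10Eq24Cumulant

section CgfTaylor

variable {Ω : Type*} {mΩ : MeasurableSpace Ω} {V : Ω → ℝ} {ν : Measure Ω} {B : ℝ} [IsFiniteMeasure ν]

/-- Taylor's formula with INTEGRAL remainder to second order on `[0, 1]` for a `C²` function `f : ℝ → ℝ`:
`f 1 − f 0 − f′ 0 = ∫₀¹ (1 − t)·f″(t) dt` (integration by parts + FTC). [folklore] -/
theorem sub_sub_deriv_eq_integral_of_contDiff_two {f : ℝ → ℝ} (hf : ContDiff ℝ 2 f) :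
    f 1 - f 0 - deriv f 0 = ∫ t in (0 : ℝ)..1, (1 - t) * iteratedDeriv 2 f t := by
  have h1 : Differentiable ℝ f := hf.differentiable (by norm_num)
  have hf' : ContDiff ℝ ((1 : WithTop ℕ∞) + 1) f := by rw [one_add_one_eq_two]; exact hf
  have h2 : ContDiff ℝ 1 (deriv f) := (contDiff_succ_iff_deriv.mp hf').2.2
  have h2d : Differentiable ℝ (deriv f) := h2.differentiable (by norm_num)
  have h2c : Continuous (deriv (deriv f)) := h2.continuous_deriv le_rfl
  have hi2 : iteratedDeriv 2 f = deriv (deriv f) := by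
    rw [show (2 : ℕ) = 1 + 1 from rfl, iteratedDeriv_succ, iteratedDeriv_one]
  rw [hi2]
  have hparts := intervalIntegral.integral_mul_deriv_eq_deriv_mul (a := (0 : ℝ)) (b := 1)
    (u := fun t : ℝ => 1 - t) (u' := fun _ => (-1 : ℝ)) (v := deriv f) (v' := deriv (deriv f))
    (fun t _ => by simpa using (hasDerivAt_id t).const_sub 1)
    (fun t _ => (h2d t).hasDerivAt)
    (continuous_const.intervalIntegrable _ _) (h2c.intervalIntegrable _ _)
  have hftc : ∫ t in (0 : ℝ)..1, deriv f t = f 1 - f 0 :=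
    intervalIntegral.integral_eq_sub_of_hasDerivAt (fun t _ => (h1 t).hasDerivAt)
      ((h2.continuous).intervalIntegrable _ _)
  rw [hparts]
  simp only [sub_self, zero_mul, sub_zero, one_mul, zero_sub, neg_mul, intervalIntegral.integral_neg, sub_neg_eq_add]
  rw [hftc]; ring

/-- **THE CUMULANT TAYLOR FORMULA WITH INTEGRAL REMAINDER** for a bounded variable under a finite measure:
`log ∫ e^{V} dν − log ν(univ) − f′(0) = ∫₀¹ (1 − t)·f″(t) dt`, `f = cgf V ν` (`f′(0)` = the mean of `V` under `ν∕ν(univ)`,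
`f″(t)` = the variance of `V` under the tilted law `e^{tV}ν∕Z(t)` — Mathlib `integral_tilted_mul_self`, `variance_tilted_mul`). [folklore] -/
theorem cgf_one_sub_cgf_zero_sub_deriv_eq_integral (hV : AEMeasurable V ν) (hB : ∀ᵐ ω ∂ν, |V ω| ≤ B) :
    cgf V ν 1 - cgf V ν 0 - deriv (cgf V ν) 0 = ∫ t in (0 : ℝ)..1, (1 - t) * iteratedDeriv 2 (cgf V ν) t :=
  sub_sub_deriv_eq_integral_of_contDiff_two (contDiff_cgf_of_abs_le hV hB)


/-- **The tilted variance is continuous in the tilt** for a bounded variable under a finite measure: `t ↦ Var[V; ν.tilted (t·V)] = f″(t)`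
(Mathlib `variance_tilted_mul`) and `f = cgf V ν` is smooth (tree ✓`B10Eq24Cumulant.contDiff_cgf_of_abs_le`). [folklore] -/
theorem continuous_variance_tilted_of_abs_le (hV : AEMeasurable V ν) (hB : ∀ᵐ ω ∂ν, |V ω| ≤ B) :
    Continuous fun t : ℝ => variance V (ν.tilted fun ω => t * V ω) := by
  have h : (fun t : ℝ => variance V (ν.tilted fun ω => t * V ω)) = fun t => iteratedDeriv 2 (cgf V ν) t :=
    funext fun t => variance_tilted_mul (mem_interior_integrableExpSet_of_abs_le hV hB t)
  rw [h]
  exact (contDiff_cgf_of_abs_le hV hB (n := 2)).continuous_iteratedDeriv 2 le_rfl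

/-- … so the cumulant Taylor formula reads `f(1) − f(0) − f′(0) = ∫₀¹ (1 − t)·Var[V; ν.tilted (t·V)] dt`. [folklore] -/
theorem cgf_one_sub_cgf_zero_sub_deriv_eq_integral_variance (hV : AEMeasurable V ν) (hB : ∀ᵐ ω ∂ν, |V ω| ≤ B) :
    cgf V ν 1 - cgf V ν 0 - deriv (cgf V ν) 0 = ∫ t in (0 : ℝ)..1, (1 - t) * variance V (ν.tilted fun ω => t * V ω) := by
  rw [cgf_one_sub_cgf_zero_sub_deriv_eq_integral hV hB]
  refine intervalIntegral.integral_congr fun t _ => ?_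
  show (1 - t) * iteratedDeriv 2 (cgf V ν) t = (1 - t) * variance V (ν.tilted fun ω => t * V ω)
  rw [variance_tilted_mul (mem_interior_integrableExpSet_of_abs_le hV hB t)]

end CgfTaylor

section FourPoint

/-- `∫₀¹ (1 − t) dt = 1∕2`. [folklore] -/
theorem integral_one_sub_id : ∫ t in (0 : ℝ)..1, (1 - t) = 1 / 2 := by
  rw [intervalIntegral.integral_sub intervalIntegrable_const intervalIntegral.intervalIntegrable_id]
  simp; norm_num

/-- **Four-point combinations pass under the `t`-integral**: if four continuous functions `A_U, A_V, A_W, A_Z` of `t ∈ [0, 1]` have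
their four-point combination bounded by `W₀·e` on `[0, 1]`, then the four-point combination of the `∫₀¹ (1 − t)·A_•(t) dt` is bounded
by `(W₀ ∕ 2)·e`. [folklore] -/
theorem abs_fourPoint_integral_le {AU AV AW AZ : ℝ → ℝ} (hU : Continuous AU) (hV : Continuous AV) (hW : Continuous AW)
    (hZ : Continuous AZ) {W₀ e : ℝ}
    (h : ∀ t ∈ Icc (0 : ℝ) 1, |AU t - AV t - (AW t - AZ t)| ≤ W₀ * e) :
    |(∫ t in (0 : ℝ)..1, (1 - t) * AU t) - (∫ t in (0 : ℝ)..1, (1 - t) * AV t) -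
        ((∫ t in (0 : ℝ)..1, (1 - t) * AW t) - (∫ t in (0 : ℝ)..1, (1 - t) * AZ t))| ≤ W₀ / 2 * e := by
  have hi : ∀ {g : ℝ → ℝ}, Continuous g → IntervalIntegrable (fun t => (1 - t) * g t) volume 0 1 :=
    fun hg => ((continuous_const.sub continuous_id).mul hg).intervalIntegrable _ _
  have hcomb : (∫ t in (0 : ℝ)..1, (1 - t) * AU t) - (∫ t in (0 : ℝ)..1, (1 - t) * AV t) -
      ((∫ t in (0 : ℝ)..1, (1 - t) * AW t) - (∫ t in (0 : ℝ)..1, (1 - t) * AZ t)) =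
      ∫ t in (0 : ℝ)..1, (1 - t) * (AU t - AV t - (AW t - AZ t)) := by
    rw [← intervalIntegral.integral_sub (hi hU) (hi hV), ← intervalIntegral.integral_sub (hi hW) (hi hZ),
      ← intervalIntegral.integral_sub ((hi hU).sub (hi hV)) ((hi hW).sub (hi hZ))]
    refine intervalIntegral.integral_congr fun t _ => ?_
    ring
  rw [hcomb]
  have hD : Continuous fun t => AU t - AV t - (AW t - AZ t) := (hU.sub hV).sub (hW.sub hZ)
  calc |∫ t in (0 : ℝ)..1, (1 - t) * (AU t - AV t - (AW t - AZ t))|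
      ≤ ∫ t in (0 : ℝ)..1, |(1 - t) * (AU t - AV t - (AW t - AZ t))| :=
        intervalIntegral.abs_integral_le_integral_abs zero_le_one
    _ ≤ ∫ t in (0 : ℝ)..1, (1 - t) * (W₀ * e) := by
        refine intervalIntegral.integral_mono_on zero_le_one ((hi hD).abs) (hi continuous_const) fun t ht => ?_
        rw [abs_mul, abs_of_nonneg (by linarith [ht.2] : (0 : ℝ) ≤ 1 - t)]
        exact mul_le_mul_of_nonneg_left (h t ht) (by linarith [ht.2])
    _ = W₀ / 2 * e := by
        rw [intervalIntegral.integral_mul_const, integral_one_sub_id]; ring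


/-- **FOUR-POINT TRANSFER THROUGH AN INTEGRAL REPRESENTATION**: if on a set `S` a function `q` is represented as `q x = ∫₀¹ (1 − t)·A_x(t) dt`
with `A_x` continuous, then any four-point combination of `q` over points of `S` is bounded by HALF the `t`-uniform bound on the same
combination of the `A_x`. (The JEN∘ use: `q` = the Jensen gap, `A_V(t)` = the tilted fibre variance.) [folklore] -/
theorem abs_fourPoint_le_of_eq_integral {X : Type*} {S : Set X} {q : X → ℝ} {A : X → ℝ → ℝ}
    (hq : ∀ x ∈ S, Continuous (A x) ∧ q x = ∫ t in (0 : ℝ)..1, (1 - t) * A x t)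
    {U V W Z : X} (hU : U ∈ S) (hV : V ∈ S) (hW : W ∈ S) (hZ : Z ∈ S) {W₀ e : ℝ}
    (h4 : ∀ t ∈ Icc (0 : ℝ) 1, |A U t - A V t - (A W t - A Z t)| ≤ W₀ * e) :
    |q U - q V - (q W - q Z)| ≤ W₀ / 2 * e := by
  rw [(hq U hU).2, (hq V hV).2, (hq W hW).2, (hq Z hZ).2]
  exact abs_fourPoint_integral_le (hq U hU).1 (hq V hV).1 (hq W hW).1 (hq Z hZ).1 h4

end FourPoint

section DisintegrationDensity

variable {X Y : Type*} [MeasurableSpace X] [MeasurableSpace Y]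

/-- **A DISINTEGRATION COMPUTES PUSH-FORWARD DENSITIES**: if `(m.map d).bind σ = m` with `σ_V` carried by the fibre `{d = V}` for
`(m.map d)`-a.e. `V`, then for every measurable `F ≥ 0`: `(F·m).map d = (V ↦ ∫ F dσ_V)·(m.map d)`. [folklore] -/
theorem map_withDensity_eq_withDensity_lintegral (m : Measure Y) {d : Y → X} (hd : Measurable d)
    (σ : Kernel X Y) [IsMarkovKernel σ] (hbind : (m.map d).bind ⇑σ = m)
    (hfib : ∀ᵐ V ∂(m.map d), ∀ᵐ U ∂(σ V), d U = V) {F : Y → ℝ≥0∞} (hF : Measurable F) :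
    (m.withDensity F).map d = (m.map d).withDensity (fun V => ∫⁻ U, F U ∂(σ V)) := by
  ext A hA
  rw [Measure.map_apply hd hA, withDensity_apply _ (hd hA), withDensity_apply _ hA,
    ← lintegral_indicator (hd hA), ← lintegral_indicator hA]
  have hg : Measurable ((d ⁻¹' A).indicator F) := hF.indicator (hd hA)
  have h1 : ∫⁻ U, (d ⁻¹' A).indicator F U ∂m = ∫⁻ U, (d ⁻¹' A).indicator F U ∂((m.map d).bind ⇑σ) := by rw [hbind]
  rw [h1, Measure.lintegral_bind σ.measurable.aemeasurable hg.aemeasurable]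
  refine lintegral_congr_ae ?_
  filter_upwards [hfib] with V hV
  by_cases hVA : V ∈ A
  · rw [Set.indicator_of_mem hVA]
    refine lintegral_congr_ae ?_
    filter_upwards [hV] with U hU
    exact Set.indicator_of_mem (show U ∈ d ⁻¹' A by rw [Set.mem_preimage, hU]; exact hVA) F
  · rw [Set.indicator_of_notMem hVA]
    refine (lintegral_congr_ae ?_).trans lintegral_zero
    filter_upwards [hV] with U hU
    exact Set.indicator_of_notMem (show U ∉ d ⁻¹' A by rw [Set.mem_preimage, hU]; exact hVA) F

end DisintegrationDensity

end Summit.QuantumFields.YangMills.Theorems.OrganTangentJensenGapTools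

end
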